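import Literature.Computability.Cryptography.FpGoldreichLevin
import Literature.Computability.Complexity.AveragingCounting
import HarnessLib

/-!
# From a predictor of the `𝔽_p`-Goldreich–Levin symbol of `f^k` to a weak direct-product oracle

Groundwork for the named fact `Literature.Computability.Learning.cikk_learn_AC0Mod` (CIKK 2016
Cor. 5.4), odd primes: CIKK Claim 4.4 / §4.2 ("the proof is identical … for `AC⁰[p]`") in exact
counting form over `𝔽_p`. If a predictor `C₂(x⃗, r)` agrees with `(f^k)^{GL}(x⃗, r) = Σᵢ rᵢ f(xᵢ)`
(`r ∈ 𝔽_pᵏ`) on at least a `1/p + γ` fraction of the pairs, then for at least an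
`η = γ/(8 p^{kk})` fraction of the (seed tuple, guess) pairs, the candidate `glCandG` of
`FpGoldreichLevin.lean` computed from the guess (the algorithm's form: `⟨x, r_c⟩` replaced by
`Σ_t c_t σ_t`) equals `f^k(x⃗)` on at least an `η` fraction of the tuples `x⃗`:

* `dpVecP`, `dpGLP`; the guess-driven histograms `histIG`, `hist0G`, test `AlignTestG` and
  candidate `glCandG`, with `glCandG_trueGuess : glCandG … (trueGuessP x s) = glCandP … x …`;
* `card_goodRows_ge_base` (averaging with base rate `β`), **`card_goodSeedGuess_ge_p`**.

## References

* M. Carmosino, R. Impagliazzo, V. Kabanets, A. Kolokolova, *Learning algorithms from natural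
  proofs*, CCC 2016, Claim 4.4, Thm. 4.2, §4.2 [CarmosinoImpagliazzoKabanetsKolokolova2016].
-/

namespace Literature.Computability.Cryptography

open Finset Matrix Literature.Computability.Complexity

variable {U : Type*} [Fintype U] {p : ℕ} [hp : Fact p.Prime] {n k kk : ℕ}

/-! ### Averaging with a base rate -/

omit hp in
/-- **Averaging**: if `P` holds for at least a `β + γ` fraction of the pairs, then for at least a
`γ/2` fraction of the rows it holds for at least a `β + γ/2` fraction of the row. [folklore] -/
theorem card_goodRows_ge_base {A B : Type*} [Fintype A] [Fintype B] [Nonempty B] (P : A → B → Prop)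
    [∀ a b, Decidable (P a b)] {β γ : ℝ} (hβ : 0 ≤ β) (hγ : 0 ≤ γ)
    (h : (β + γ) * (Fintype.card A * Fintype.card B) ≤ ((univ.filter fun q : A × B => P q.1 q.2).card : ℝ)) :
    γ / 2 * Fintype.card A ≤
      ((univ.filter fun a : A => (β + γ / 2) * Fintype.card B ≤ ((univ.filter fun b => P a b).card : ℝ)).card : ℝ) := by
  classical
  set good := univ.filter fun a : A => (β + γ / 2) * Fintype.card B ≤ ((univ.filter fun b => P a b).card : ℝ)
  have hrow : ∀ a : A, ((univ.filter fun b => P a b).card : ℝ) ≤ Fintype.card B := fun a => by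
    exact_mod_cast (card_filter_le _ _).trans_eq (card_univ)
  have htot : ((univ.filter fun q : A × B => P q.1 q.2).card : ℝ) = ∑ a : A, ((univ.filter fun b => P a b).card : ℝ) := by
    rw [natCast_card_filter, Fintype.sum_prod_type]
    exact Finset.sum_congr rfl fun a _ => by rw [natCast_card_filter]
  have hbad : ((univ.filter fun a : A => ¬ ((β + γ / 2) * Fintype.card B ≤
      ((univ.filter fun b => P a b).card : ℝ))).card : ℝ) ≤ Fintype.card A := by
    exact_mod_cast (card_filter_le _ _).trans_eq (card_univ)
  have hsplit : (∑ a : A, ((univ.filter fun b => P a b).card : ℝ)) ≤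
      good.card * Fintype.card B + Fintype.card A * ((β + γ / 2) * Fintype.card B) := by
    rw [← Finset.sum_filter_add_sum_filter_not univ (fun a : A =>
      (β + γ / 2) * Fintype.card B ≤ ((univ.filter fun b => P a b).card : ℝ))]
    refine add_le_add ?_ ?_
    · rw [← nsmul_eq_mul, ← Finset.sum_const]
      exact Finset.sum_le_sum fun a _ => hrow a
    · calc (∑ a ∈ univ.filter (fun a : A => ¬ ((β + γ / 2) * Fintype.card B ≤
            ((univ.filter fun b => P a b).card : ℝ))), ((univ.filter fun b => P a b).card : ℝ))
          ≤ ∑ _a ∈ univ.filter (fun a : A => ¬ ((β + γ / 2) * Fintype.card B ≤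
            ((univ.filter fun b => P a b).card : ℝ))), ((β + γ / 2) * Fintype.card B) :=
            Finset.sum_le_sum fun a ha => (not_le.1 (mem_filter.1 ha).2).le
        _ ≤ Fintype.card A * ((β + γ / 2) * Fintype.card B) := by
            rw [Finset.sum_const, nsmul_eq_mul]
            exact mul_le_mul_of_nonneg_right hbad (by positivity)
  rw [htot] at h
  have hBpos : (0 : ℝ) < Fintype.card B := Nat.cast_pos.2 Fintype.card_pos
  have hg0 : (0 : ℝ) ≤ good.card := Nat.cast_nonneg _
  nlinarith [h, hsplit]

/-! ### The direct product over `𝔽_p` and the guess-driven candidate -/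

/-- The direct product `f^k(x⃗)` as a `0/1`-vector over `𝔽_p`. [cite: CarmosinoImpagliazzoKabanetsKolokolova2016, §4.2 ("`g = f^k`")] -/
def dpVecP (f : U → Bool) (xs : Fin k → U) : FVec p k := fun i => if f (xs i) then 1 else 0

/-- The `𝔽_p`-Goldreich–Levin symbol `(f^k)^{GL}(x⃗, r) = Σᵢ rᵢ f(xᵢ)`. [cite: CarmosinoImpagliazzoKabanetsKolokolova2016, §4 (definition of `g^{GL}` over `GF(p)`)] -/
def dpGLP (f : U → Bool) (q : (Fin k → U) × FVec p k) : ZMod p := dpVecP f q.1 ⬝ᵥ q.2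

/-- The correct guess `σ_t = ⟨x, sᵗ⟩`. [folklore] -/
def trueGuessP (x : FVec p n) (s : Fin kk → FVec p n) : Fin kk → ZMod p := fun t => x ⬝ᵥ s t

variable (kk)

/-- The guessed inner product `Σ_t c_t σ_t` (`= ⟨x, r_c⟩` for the correct guess). [folklore] -/
def guessDot (σ : Fin kk → ZMod p) (c : Fin kk → ZMod p) : ZMod p := ∑ t, c t * σ t

/-- For the correct guess the guessed inner product is the true one. [folklore] -/
theorem guessDot_trueGuess (x : FVec p n) (s : Fin kk → FVec p n) (c : Fin kk → ZMod p) :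
    guessDot kk (trueGuessP x s) c = x ⬝ᵥ seedComb s c := by
  rw [dotProduct_seedComb]; rfl

/-- The vote histogram driven by the guess. [cite: CarmosinoImpagliazzoKabanetsKolokolova2016, Thm. 4.2 (algorithm)] -/
def histIG (B : FVec p n → ZMod p) (σ : Fin kk → ZMod p) (s : Fin kk → FVec p n) (i : Fin n) (v : ZMod p) : ℕ :=
  ((reps p kk).filter fun c => B (seedComb s c + Pi.single i 1) - guessDot kk σ c = v).card

/-- The noise histogram driven by the guess. [folklore] -/
def hist0G (B : FVec p n → ZMod p) (σ : Fin kk → ZMod p) (s : Fin kk → FVec p n) (w : ZMod p) : ℕ :=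
  ((reps p kk).filter fun c => B (seedComb s c) - guessDot kk σ c = w).card

/-- The alignment test driven by the guess. [folklore] -/
def AlignTestG (B : FVec p n → ZMod p) (σ : Fin kk → ZMod p) (η : ℝ) (s : Fin kk → FVec p n) (i : Fin n) (a : ZMod p) : Prop :=
  ∀ w : ZMod p, |(histIG kk B σ s i (a + w) : ℝ) - hist0G kk B σ s w| ≤ 2 * η * (reps p kk).card

/-- **The candidate driven by the guess** (what the algorithm computes). [cite: CarmosinoImpagliazzoKabanetsKolokolova2016, Thm. 4.2 (GL reconstruction algorithm)] -/
noncomputable def glCandG (B : FVec p n → ZMod p) (σ : Fin kk → ZMod p) (η : ℝ) (s : Fin kk → FVec p n) : FVec p n :=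
  fun i =>
  open scoped Classical in
  if h : (univ.filter fun a : ZMod p => AlignTestG kk B σ η s i a).Nonempty then
    Classical.choose ((univ.filter fun a : ZMod p => AlignTestG kk B σ η s i a).exists_min_image ZMod.val h)
  else 0

/-- **With the correct guess the guess-driven candidate is the candidate of `FpGoldreichLevin`.** [folklore] -/
theorem glCandG_trueGuess (B : FVec p n → ZMod p) (x : FVec p n) (η : ℝ) (s : Fin kk → FVec p n) :
    glCandG kk B (trueGuessP x s) η s = glCandP kk B x η s := by
  have hT : AlignTestG kk B (trueGuessP x s) η s = AlignTest kk B x η s := by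
    funext i a
    unfold AlignTestG AlignTest histIG histI hist0G hist0
    simp_rw [guessDot_trueGuess]
  funext i
  show (open scoped Classical in
    if h : (univ.filter fun a : ZMod p => AlignTestG kk B (trueGuessP x s) η s i a).Nonempty then
      Classical.choose ((univ.filter fun a : ZMod p => AlignTestG kk B (trueGuessP x s) η s i a).exists_min_image ZMod.val h)
    else 0) = _
  rw [hT]
  rfl

/-! ### The direct-product statement -/

/-- **CIKK Claim 4.4 over `𝔽_p`, counting form.** If `C₂` agrees with `Σᵢ rᵢ f(xᵢ)` on at least a
`1/p + γ` fraction of the pairs `(x⃗, r)` and the number `m` of queries has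
`(k+1) p ≤ 2 (γ/(8p))² m`, then for at least an `η = γ/(8 p^{kk})` fraction of the pairs
(seed tuple `s`, guess `σ`), the guess-driven candidate `x⃗ ↦ glCandG (C₂(x⃗, ·)) σ (γ/(8p)) s`
equals `f^k(x⃗)` on at least an `η` fraction of the tuples. [cite: CarmosinoImpagliazzoKabanetsKolokolova2016, Claim 4.4 / §4.2] -/
theorem card_goodSeedGuess_ge_p [Nonempty U] (f : U → Bool) (C₂ : (Fin k → U) × FVec p k → ZMod p) {γ : ℝ} (hγ : 0 < γ)
    (hm0 : 0 < (reps p kk).card) (hm : ((k + 1) * p : ℝ) ≤ 2 * (γ / 2 / (4 * p)) ^ 2 * (reps p kk).card)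
    (h : (1 / p + γ) * (Fintype.card (Fin k → U) * Fintype.card (FVec p k)) ≤
      ((univ.filter fun q : (Fin k → U) × FVec p k => C₂ q = dpGLP f q).card : ℝ)) :
    γ / (8 * p ^ kk) * Fintype.card ((Fin kk → FVec p k) × (Fin kk → ZMod p)) ≤
      ((univ.filter fun q : (Fin kk → FVec p k) × (Fin kk → ZMod p) =>
        γ / (8 * p ^ kk) * Fintype.card (Fin k → U) ≤
          ((univ.filter fun xs : Fin k → U =>
            glCandG kk (fun r => C₂ (xs, r)) q.2 (γ / 2 / (4 * p)) q.1 = dpVecP f xs).card : ℝ)).card : ℝ) := by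
  classical
  have hpR : (0 : ℝ) < p := by exact_mod_cast hp.out.pos
  set cand : (Fin kk → FVec p k) × (Fin kk → ZMod p) → (Fin k → U) → FVec p k := fun q xs =>
    glCandG kk (fun r => C₂ (xs, r)) q.2 (γ / 2 / (4 * p)) q.1 with hcand
  -- Step 1: many rows have agreement `≥ 1/p + γ/2`
  have hrows := card_goodRows_ge_base (A := Fin k → U) (B := FVec p k)
    (fun xs r => C₂ (xs, r) = dpVecP f xs ⬝ᵥ r) (β := 1 / p) (by positivity) hγ.le (by exact h)
  set goodRows := univ.filter fun xs : Fin k → U =>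
    (1 / p + γ / 2) * Fintype.card (FVec p k) ≤ ((univ.filter fun r : FVec p k => C₂ (xs, r) = dpVecP f xs ⬝ᵥ r).card : ℝ)
    with hgoodRows
  -- Step 2: on a good row, for half of the seeds the correct guess gives the secret
  have hGL : ∀ xs ∈ goodRows, (Fintype.card (Fin kk → FVec p k) : ℝ) / 2 ≤
      ((univ.filter fun q : (Fin kk → FVec p k) × (Fin kk → ZMod p) => cand q xs = dpVecP f xs).card : ℝ) := by
    intro xs hxs
    have hB := (mem_filter.1 hxs).2
    have hnoise : (1 / p + γ / 2) * Fintype.card (FVec p k) ≤ ((noiseSet (fun r => C₂ (xs, r)) (dpVecP f xs) 0).card : ℝ) := by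
      refine hB.trans (le_of_eq ?_)
      congr 2; unfold noiseSet; congr 1; ext r; simp [sub_eq_zero]
    have hhalf := fp_goldreich_levin_half kk (fun r => C₂ (xs, r)) (dpVecP f xs) (γ := γ / 2) (by positivity) hnoise hm0
      (by exact_mod_cast hm)
    refine hhalf.trans ?_
    -- `s ↦ (s, trueGuess)` is injective into the good pairs
    exact_mod_cast Finset.card_le_card_of_injOn (fun s => (s, trueGuessP (dpVecP f xs) s))
      (fun s hs => by
        rw [mem_coe, mem_filter] at hs ⊢
        refine ⟨mem_univ _, ?_⟩
        rw [hcand]; dsimp only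
        rw [glCandG_trueGuess]; exact_mod_cast hs.2)
      (fun s _ s' _ heq => (Prod.ext_iff.1 heq).1)
  -- Step 3: hence many good triples (seed, guess, row)
  have hGs : (Fintype.card (Fin kk → ZMod p) : ℝ) = p ^ kk := by simp
  have hSdGs : (Fintype.card ((Fin kk → FVec p k) × (Fin kk → ZMod p)) : ℝ) = Fintype.card (Fin kk → FVec p k) * p ^ kk := by
    rw [Fintype.card_prod, Nat.cast_mul, hGs]
  have hp0 : (0 : ℝ) < p ^ kk := by positivity
  have htriples : γ / (4 * p ^ kk) *
      (Fintype.card ((Fin kk → FVec p k) × (Fin kk → ZMod p)) * Fintype.card (Fin k → U)) ≤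
      ((univ.filter fun t : ((Fin kk → FVec p k) × (Fin kk → ZMod p)) × (Fin k → U) =>
        cand t.1 t.2 = dpVecP f t.2).card : ℝ) := by
    have hcount : ((univ.filter fun t : ((Fin kk → FVec p k) × (Fin kk → ZMod p)) × (Fin k → U) =>
        cand t.1 t.2 = dpVecP f t.2).card : ℝ) =
        ∑ xs : Fin k → U, ((univ.filter fun q : (Fin kk → FVec p k) × (Fin kk → ZMod p) => cand q xs = dpVecP f xs).card : ℝ) := by
      rw [natCast_card_filter, Fintype.sum_prod_type_right]
      exact Finset.sum_congr rfl fun xs _ => by rw [natCast_card_filter]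
    rw [hcount, hSdGs]
    calc γ / (4 * p ^ kk) * (Fintype.card (Fin kk → FVec p k) * p ^ kk * Fintype.card (Fin k → U))
        = (γ / 2 * Fintype.card (Fin k → U)) * ((Fintype.card (Fin kk → FVec p k) : ℝ) / 2) := by
          field_simp; ring
      _ ≤ goodRows.card * ((Fintype.card (Fin kk → FVec p k) : ℝ) / 2) := mul_le_mul_of_nonneg_right hrows (by positivity)
      _ = ∑ _xs ∈ goodRows, (Fintype.card (Fin kk → FVec p k) : ℝ) / 2 := by rw [Finset.sum_const, nsmul_eq_mul]
      _ ≤ ∑ xs ∈ goodRows, ((univ.filter fun q : (Fin kk → FVec p k) × (Fin kk → ZMod p) => cand q xs = dpVecP f xs).card : ℝ) :=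
          Finset.sum_le_sum hGL
      _ ≤ ∑ xs : Fin k → U, ((univ.filter fun q : (Fin kk → FVec p k) × (Fin kk → ZMod p) => cand q xs = dpVecP f xs).card : ℝ) :=
          Finset.sum_le_sum_of_subset_of_nonneg (subset_univ _) fun _ _ _ => Nat.cast_nonneg _
  -- Step 4: averaging over (seed, guess)
  have hfinal := card_rows_ge_of_density (A := (Fin kk → FVec p k) × (Fin kk → ZMod p))
    (B := Fin k → U) (fun q xs => cand q xs = dpVecP f xs) (ρ := γ / (4 * p ^ kk)) (by positivity) htriples
  have hρ : γ / (4 * p ^ kk) / 2 = γ / (8 * p ^ kk) := by ring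
  rw [hρ] at hfinal
  exact hfinal

end Literature.Computability.Cryptography
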